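import Summits.BirchSwinnertonDyer.Rank1Residual.Additive.CongruentLambdaShiftOfGVTorsionIso
import Summits.BirchSwinnertonDyer.Rank1Residual.AdditivePotMult.PotMultGreenbergKummerPairs
import Summits.BirchSwinnertonDyer.Rank1Residual.AdditivePotMult.PotMultRamifiedLineKummerEqAt
import Summits.BirchSwinnertonDyer.Rank1Residual.Additive.TorsionOrderOfTorsionIso
import HarnessLib

/-!
# Route G on (M)–(M) congruent pairs via the Greenberg–Vatsal record, with EVERY line / R-D binder
# DISCHARGED: `CongruentLambdaShift` and the `μ = 0` transfer from `TorsionIso` alone, mod GV §2 +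
# A40/A41 (cell `b2b-bsdres`, team n1011, seat p07 (gen 5); row T-RD-M sequel (iv) — the consumer of
# `PotMultGreenbergKummerPairs` (lines, matched) and `PotMultRamifiedLineKummerEqAt` (R-D, `∀ L`))

HONEST FRAMING (cell `b2b-bsdres`, run/shared/lean/b2b/bsd-rank1-residual/, verbatim in every
file): the goal of the cell is to DELETE the COMBINATION-SHAPED residual classes of the
Birch–Swinnerton-Dyer formula for ALL analytic-rank `≤ 1` elliptic curves over `ℚ` — "full BSD
formula for every rank `≤ 1` curve in class `C`" assembled STRICTLY from published theorems — so
that the rank-`≤ 1` remainder becomes exactly the CONSTRUCTION-SHAPED classes, which are TYPED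
(missing-input `Prop`s), NOT attempted. This is not "finishing BSD". Team n1011 (N10/N11, (M) rows):
research route; labels and marks UNCHANGED; nothing booked. Consumer theorems only; NO definition; NO
Literature fact; the named facts entering as HYPOTHESES are cc-typer-2's GV §2 composed record `hGV`
(`GreenbergVatsal2000.muLambdaAlg_transfer_of_torsionIso_potOrd_of_not_dvd_torsionOrder`, C-audited
LIT-INPUTS-P3 §42) and the published Tate uniformisation A40/A41 (`hT40`/`hT41`). Debt 0.

## What

cc-typer-2's `Additive/CongruentLambdaShiftOfGVTorsionIso.lean` §1 gives Route G's typed input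
`CongruentLambdaShift W₁ W₂ p e` and the `μ = 0` transfer from the GV record for two globally minimal
curves GIVEN: ramified ordinary lines `L₁`, `L₂` at `v ∋ p`, a `Γ_ℚ`-equivariant `E₁[p] ≃ E₂[p]`
respecting them, `p ∤ #Eᵢ(ℚ)_tors`, the R-D identifications `RamifiedLineKummerEqAt Wᵢ p`, and
`Σ₀`; its §2–§3 instantiate this on the (G-ord) rows only. On the (M) rows (`PotMult Wᵢ p`: additive,
potentially multiplicative at the odd `p`) ALL the local inputs are now theorems of the tree modulo
A40/A41: the lines and their matching under EVERY equivariant `E₁[p] ≃ E₂[p]`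
(`PotMult.exists_lines_matching_kummer`, `PotMultGreenbergKummerPairs`), and the `∀ L` R-D
identification (`PotMult.ramifiedLineKummerEqAt`, `PotMultRamifiedLineKummerEqAt`, over cc-typer-2's
uniqueness `RamifiedOrdinaryLineUniquePotMult`). Hence:
* `PotMult.exists_isRamifiedOrdinaryLine_pair_matching` — the `κ`-free matched pair of lines;
* `PotMult.congruentLambdaShift_of_gv_of_torsionIso`, `PotMult.mu_eq_zero_of_gv_of_torsionIso` —
  inputs: `hGV`, A40/A41, `p ≠ 2`, `p ∤ #Eᵢ(ℚ)_tors`, `TorsionIso W₁ W₂ p`, `Σ₀`; NO line, NO R-D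
  binder, NO image hypothesis;
* `ClassX4M.…` (torsion conditions discharged by irreducibility, `ClassX4M.not_dvd_torsionOrder`,
  Mazur) — an EPW-FREE second source for the X4(M)–X4(M) node;
* `ClassX3M.…` — **the X3♯(M)–X3♯(M) node for real** (the EPW record is inapplicable on X3, `ρ̄`
  reducible); remaining per-pair inputs: `TorsionIso` (certificate), ONE census bit `p ∤ #E₁(ℚ)_tors` (the
  partner's follows: cc-typer-2's `not_dvd_torsionOrder_of_torsionIso`, `TorsionOrderOfTorsionIso`), `Σ₀`.
X3♯(M) / X4(M) stay CONSTRUCTION-SHAPED; nothing booked; no mark moved. Mixed (M)–(G-ord) pairs are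
NOT treated here.

References: R. Greenberg, V. Vatsal, Invent. Math. 142 (2000) §2 Props. (2.4), (2.8), Remarks
(2.7), (2.9), (2.10), Cor. (2.3), pp. 26–27; R. Greenberg, LNM 1716 (1999) Prop. 4.14, §2 pp. 74–76;
B. Mazur, Publ. IHÉS 47 (1977) III §5; J. H. Silverman, *ATAEC* V.5.3, Cor. V.5.4.
-/

noncomputable section

open scoped Classical NumberField

namespace Summit.BirchSwinnertonDyer.Rank1Residual.AdditivePotMult

open NumberField IsDedekindDomain Field WeierstrassCurve
  Literature.NumberTheory.GaloisRepresentations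
  Literature.NumberTheory.EllipticCurves
  Literature.NumberTheory.EllipticCurves.Rank1Residual
  Literature.NumberTheory.EllipticCurves.GreenbergSelmer
  Literature.NumberTheory.EllipticCurves.GreenbergVatsal2000
  Literature.NumberTheory.EllipticCurves.EmertonPollackWeston2006
  Summit.BirchSwinnertonDyer.Rank1Residual.X1.CongruenceTransfer
  Summit.BirchSwinnertonDyer.Rank1Residual.Additive

variable {p : ℕ} [hp : Fact p.Prime] {W₁ W₂ : WeierstrassCurve ℚ} [W₁.IsElliptic] [W₂.IsElliptic]

/-- The place `v_p` of `ℚ` above `p` (`Rat.HeightOneSpectrum.primesEquiv`). [folklore] -/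
private theorem exists_natCast_mem_asIdeal :
    ∃ v : HeightOneSpectrum (𝓞 ℚ), ((p : ℕ) : 𝓞 ℚ) ∈ v.asIdeal :=
  ⟨(Rat.HeightOneSpectrum.primesEquiv (R := 𝓞 ℚ)).symm ⟨p, hp.out⟩,
    (natCast_mem_asIdeal_iff_eq_primesEquiv_symm _ hp.out).mpr rfl⟩

/-- On an X4(M) row the torsion condition of the GV record is automatic: `E[p]` irreducible ⟹
`p ∤ #E(ℚ)_tors` (Mazur 1977 III §5; tree `not_hasIrreducibleModPGaloisRep_of_dvd_torsionOrder`;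
twin of cc-typer-2's `ClassX4Gord.not_dvd_torsionOrder`). [cite: Mazur1977, Ch. III §5, p. 157] -/
theorem ClassX4M.not_dvd_torsionOrder (hX : ClassX4M W₁ p) : ¬ p ∣ W₁.torsionOrder :=
  fun h ↦ not_hasIrreducibleModPGaloisRep_of_dvd_torsionOrder W₁ p h hX.irr

/-- **Two (M) curves at the same odd `p`: ramified ordinary lines matched under EVERY
`Γ_ℚ`-equivariant `E₁[p] ≃+ E₂[p]`** (the `κ`-free part of `PotMult.exists_lines_matching_kummer`,
taken at the cyclotomic `ℤ_p`-extension `CyclotomicZp.zpExtension p`), mod A40/A41.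
[cite: GreenbergLNM1716, §2 pp. 74–76] [cite: EmertonPollackWeston2006, pp. 2–3 and §3.1 (eq:ordes) (arXiv:math/0404484 p. 17)]
[cite: SilvermanATAEC1994, Ch. V Thm. 5.3, Cor. 5.4] -/
theorem PotMult.exists_isRamifiedOrdinaryLine_pair_matching
    (hT40 : Silverman1994_thmV53_tateUniformisation.{0})
    (hT41 : Silverman1994_thmV53_corV54_tateUniformisation.{0}) (hp2 : p ≠ 2)
    (hpm₁ : PotMult W₁ p) (hpm₂ : PotMult W₂ p)
    {v : HeightOneSpectrum (𝓞 ℚ)} (hv : ((p : ℕ) : 𝓞 ℚ) ∈ v.asIdeal) :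
    ∃ (L₁ : LocalDatum ℚ (W₁.geomPrimaryTorsion p) v) (L₂ : LocalDatum ℚ (W₂.geomPrimaryTorsion p) v),
      IsRamifiedOrdinaryLine W₁ p L₁ ∧ IsRamifiedOrdinaryLine W₂ p L₂ ∧
      ∀ e : geomTorsion W₁ (p : ℤ) ≃+ geomTorsion W₂ (p : ℤ),
        (∀ (σ : absoluteGaloisGroup ℚ) (P : geomTorsion W₁ (p : ℤ)), e (σ • P) = σ • e P) →
        ∀ P : geomTorsion W₁ (p : ℤ),
          AddSubgroup.inclusion (geomTorsion_le_geomPrimaryTorsion W₁ p) P ∈ L₁.plus ↔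
            AddSubgroup.inclusion (geomTorsion_le_geomPrimaryTorsion W₂ p) (e P) ∈ L₂.plus := by
  obtain ⟨L₁, L₂, hL₁, hL₂, -, -, -, -, hmatch⟩ := hpm₁.exists_lines_matching_kummer hT40 hT41 hp2 hpm₂
    (CyclotomicZp.zpExtension p) (CyclotomicZp.isCyclotomic_zpExtension p) hv
  exact ⟨L₁, L₂, hL₁, hL₂, hmatch⟩

section GV

variable [W₁.IsGloballyMinimal] [W₂.IsGloballyMinimal]

/-- **(M)–(M) congruent pairs, every odd `p`: Route G's typed input `CongruentLambdaShift W₁ W₂ p e`,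
`e = Σ_{w∈Σ₀} (δ(E₂,w) − δ(E₁,w))`, from the GV record + `TorsionIso W₁ W₂ p` + `p ∤ #Eᵢ(ℚ)_tors` +
`Σ₀` — NO line binder, NO R-D binder, NO image hypothesis** (lines and their matching:
`PotMult.exists_isRamifiedOrdinaryLine_pair_matching`; R-D: `PotMult.ramifiedLineKummerEqAt`), mod
A40/A41. Nothing booked.
[cite: GreenbergVatsal2000, §2 Prop. (2.8) with Remark (2.9), Cor. (2.3), Prop. (2.4), pp. 26–27 (arXiv:math/9906215)]
[cite: SilvermanATAEC1994, Ch. V Thm. 5.3, Cor. 5.4] -/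
theorem PotMult.congruentLambdaShift_of_gv_of_torsionIso
    (hGV : muLambdaAlg_transfer_of_torsionIso_potOrd_of_not_dvd_torsionOrder)
    (hT40 : Silverman1994_thmV53_tateUniformisation.{0})
    (hT41 : Silverman1994_thmV53_corV54_tateUniformisation.{0}) (hp2 : p ≠ 2)
    (hpm₁ : PotMult W₁ p) (hpm₂ : PotMult W₂ p)
    (htors₁ : ¬ p ∣ W₁.torsionOrder) (htors₂ : ¬ p ∣ W₂.torsionOrder) (hT : TorsionIso W₁ W₂ p)
    (S₀ : Finset (HeightOneSpectrum (𝓞 ℚ))) (hS₀ : ∀ w ∈ S₀, ((p : ℕ) : 𝓞 ℚ) ∉ w.asIdeal)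
    (hS₁ : ∀ w : HeightOneSpectrum (𝓞 ℚ), w ∉ S₀ → ((p : ℕ) : 𝓞 ℚ) ∉ w.asIdeal →
      W₁.HasGoodReductionAt w)
    (hS₂ : ∀ w : HeightOneSpectrum (𝓞 ℚ), w ∉ S₀ → ((p : ℕ) : 𝓞 ℚ) ∉ w.asIdeal →
      W₂.HasGoodReductionAt w) :
    CongruentLambdaShift W₁ W₂ p (∑ w ∈ S₀, ((delta W₂ p w : ℤ) - (delta W₁ p w : ℤ))) := by
  obtain ⟨v, hv⟩ := exists_natCast_mem_asIdeal (p := p)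
  obtain ⟨L₁, L₂, hL₁, hL₂, hmatch⟩ :=
    hpm₁.exists_isRamifiedOrdinaryLine_pair_matching hT40 hT41 hp2 hpm₂ hv
  obtain ⟨e, he⟩ := hT
  exact congruentLambdaShift_of_gv W₁ W₂ p S₀ hGV hp2 hv hL₁ hL₂ htors₁ htors₂
    (hpm₁.ramifiedLineKummerEqAt hT40 hT41 hp2) (hpm₂.ramifiedLineKummerEqAt hT40 hT41 hp2)
    ⟨e, he, hmatch e he⟩ hS₀ hS₁ hS₂

/-- **(M)–(M) congruent pairs, every odd `p`: `μ(X(E₁)) = 0 ⟹ μ(X(E₂)) = 0`** from the GV record +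
`TorsionIso` + `p ∤ #Eᵢ(ℚ)_tors` + `Σ₀`, for the cyclotomic data and torsion dual data — NO line / R-D /
image binder, mod A40/A41. Nothing booked.
[cite: GreenbergVatsal2000, §2 Prop. (2.8) with Remark (2.9), Cor. (2.3), pp. 26–27 (arXiv:math/9906215)]
[cite: SilvermanATAEC1994, Ch. V Thm. 5.3, Cor. 5.4] -/
theorem PotMult.mu_eq_zero_of_gv_of_torsionIso
    (hGV : muLambdaAlg_transfer_of_torsionIso_potOrd_of_not_dvd_torsionOrder)
    (hT40 : Silverman1994_thmV53_tateUniformisation.{0})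
    (hT41 : Silverman1994_thmV53_corV54_tateUniformisation.{0}) (hp2 : p ≠ 2)
    (hpm₁ : PotMult W₁ p) (hpm₂ : PotMult W₂ p)
    (htors₁ : ¬ p ∣ W₁.torsionOrder) (htors₂ : ¬ p ∣ W₂.torsionOrder) (hT : TorsionIso W₁ W₂ p)
    (S₀ : Finset (HeightOneSpectrum (𝓞 ℚ))) (hS₀ : ∀ w ∈ S₀, ((p : ℕ) : 𝓞 ℚ) ∉ w.asIdeal)
    (hS₁ : ∀ w : HeightOneSpectrum (𝓞 ℚ), w ∉ S₀ → ((p : ℕ) : 𝓞 ℚ) ∉ w.asIdeal →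
      W₁.HasGoodReductionAt w)
    (hS₂ : ∀ w : HeightOneSpectrum (𝓞 ℚ), w ∉ S₀ → ((p : ℕ) : 𝓞 ℚ) ∉ w.asIdeal →
      W₂.HasGoodReductionAt w)
    {κ : ZpExtension ℚ p} {γ : absoluteGaloisGroup ℚ} (hκ : κ.IsCyclotomic)
    (hγ : κ.IsTopGenerator γ) (hγ' : IsCyclotomicVariable p γ)
    (D₁ : W₁.SelmerDualData κ γ) (D₂ : W₂.SelmerDualData κ γ)
    [Module.Finite (IwasawaAlgebra p) D₁.X] [Module.Finite (IwasawaAlgebra p) D₂.X]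
    (hX₁ : D₁.IsTorsion) (hX₂ : D₂.IsTorsion) (hμ₁ : D₁.mu = 0) : D₂.mu = 0 := by
  obtain ⟨v, hv⟩ := exists_natCast_mem_asIdeal (p := p)
  obtain ⟨L₁, L₂, hL₁, hL₂, hmatch⟩ :=
    hpm₁.exists_isRamifiedOrdinaryLine_pair_matching hT40 hT41 hp2 hpm₂ hv
  obtain ⟨e, he⟩ := hT
  exact mu_eq_zero_of_gv W₁ W₂ p S₀ hGV hp2 hv hL₁ hL₂ htors₁ htors₂
    (hpm₁.ramifiedLineKummerEqAt hT40 hT41 hp2) (hpm₂.ramifiedLineKummerEqAt hT40 hT41 hp2)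
    ⟨e, he, hmatch e he⟩ hS₀ hS₁ hS₂ hκ hγ hγ' D₁ D₂ hX₁ hX₂ hμ₁

/-- **X4(M)–X4(M) congruent pairs, every odd `p` (`p = 3` included): `CongruentLambdaShift W₁ W₂ p e`
from the GV record + `TorsionIso W₁ W₂ p` + `Σ₀`** — an EPW-FREE second source for Route G's node on
X4(M) pairs, the torsion conditions discharged by irreducibility; NO line / R-D / image binder, mod
A40/A41. X4(M) stays CONSTRUCTION-SHAPED; nothing booked.
[cite: GreenbergVatsal2000, §2 Prop. (2.8) with Remark (2.9), Cor. (2.3), Prop. (2.4), pp. 26–27 (arXiv:math/9906215)]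
[cite: Mazur1977, Ch. III §5, p. 157] [cite: SilvermanATAEC1994, Ch. V Thm. 5.3, Cor. 5.4] -/
theorem ClassX4M.congruentLambdaShift_of_gv_of_torsionIso
    (hGV : muLambdaAlg_transfer_of_torsionIso_potOrd_of_not_dvd_torsionOrder)
    (hT40 : Silverman1994_thmV53_tateUniformisation.{0})
    (hT41 : Silverman1994_thmV53_corV54_tateUniformisation.{0})
    (hX₁ : ClassX4M W₁ p) (hX₂ : ClassX4M W₂ p) (hT : TorsionIso W₁ W₂ p)
    (S₀ : Finset (HeightOneSpectrum (𝓞 ℚ))) (hS₀ : ∀ w ∈ S₀, ((p : ℕ) : 𝓞 ℚ) ∉ w.asIdeal)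
    (hS₁ : ∀ w : HeightOneSpectrum (𝓞 ℚ), w ∉ S₀ → ((p : ℕ) : 𝓞 ℚ) ∉ w.asIdeal →
      W₁.HasGoodReductionAt w)
    (hS₂ : ∀ w : HeightOneSpectrum (𝓞 ℚ), w ∉ S₀ → ((p : ℕ) : 𝓞 ℚ) ∉ w.asIdeal →
      W₂.HasGoodReductionAt w) :
    CongruentLambdaShift W₁ W₂ p (∑ w ∈ S₀, ((delta W₂ p w : ℤ) - (delta W₁ p w : ℤ))) :=
  (ClassX4M.potMult W₁ p hX₁).congruentLambdaShift_of_gv_of_torsionIso hGV hT40 hT41 hX₁.p_ne_two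
    (ClassX4M.potMult W₂ p hX₂) hX₁.not_dvd_torsionOrder hX₂.not_dvd_torsionOrder hT S₀ hS₀ hS₁ hS₂

/-- **X4(M)–X4(M) congruent pairs: `μ(X(E₁)) = 0 ⟹ μ(X(E₂)) = 0`** from the GV record + `TorsionIso`
(EPW-free; torsion conditions by irreducibility), mod A40/A41. Nothing booked.
[cite: GreenbergVatsal2000, §2 Prop. (2.8) with Remark (2.9), Cor. (2.3), pp. 26–27 (arXiv:math/9906215)]
[cite: Mazur1977, Ch. III §5, p. 157] [cite: SilvermanATAEC1994, Ch. V Thm. 5.3, Cor. 5.4] -/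
theorem ClassX4M.mu_eq_zero_of_gv_of_torsionIso
    (hGV : muLambdaAlg_transfer_of_torsionIso_potOrd_of_not_dvd_torsionOrder)
    (hT40 : Silverman1994_thmV53_tateUniformisation.{0})
    (hT41 : Silverman1994_thmV53_corV54_tateUniformisation.{0})
    (hX₁ : ClassX4M W₁ p) (hX₂ : ClassX4M W₂ p) (hT : TorsionIso W₁ W₂ p)
    (S₀ : Finset (HeightOneSpectrum (𝓞 ℚ))) (hS₀ : ∀ w ∈ S₀, ((p : ℕ) : 𝓞 ℚ) ∉ w.asIdeal)
    (hS₁ : ∀ w : HeightOneSpectrum (𝓞 ℚ), w ∉ S₀ → ((p : ℕ) : 𝓞 ℚ) ∉ w.asIdeal →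
      W₁.HasGoodReductionAt w)
    (hS₂ : ∀ w : HeightOneSpectrum (𝓞 ℚ), w ∉ S₀ → ((p : ℕ) : 𝓞 ℚ) ∉ w.asIdeal →
      W₂.HasGoodReductionAt w)
    {κ : ZpExtension ℚ p} {γ : absoluteGaloisGroup ℚ} (hκ : κ.IsCyclotomic)
    (hγ : κ.IsTopGenerator γ) (hγ' : IsCyclotomicVariable p γ)
    (D₁ : W₁.SelmerDualData κ γ) (D₂ : W₂.SelmerDualData κ γ)
    [Module.Finite (IwasawaAlgebra p) D₁.X] [Module.Finite (IwasawaAlgebra p) D₂.X]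
    (hX₁t : D₁.IsTorsion) (hX₂t : D₂.IsTorsion) (hμ₁ : D₁.mu = 0) : D₂.mu = 0 :=
  (ClassX4M.potMult W₁ p hX₁).mu_eq_zero_of_gv_of_torsionIso hGV hT40 hT41 hX₁.p_ne_two
    (ClassX4M.potMult W₂ p hX₂) hX₁.not_dvd_torsionOrder hX₂.not_dvd_torsionOrder hT S₀ hS₀ hS₁ hS₂
    hκ hγ hγ' D₁ D₂ hX₁t hX₂t hμ₁

/-- **X3♯(M)–X3♯(M) congruent pairs (odd `p`): Route G's typed input `CongruentLambdaShift W₁ W₂ p e`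
from the GV record + `TorsionIso W₁ W₂ p` + ONE census bit `p ∤ #E₁(ℚ)_tors` (the partner's follows,
cc-typer-2's `not_dvd_torsionOrder_of_torsionIso`) + `Σ₀` — the X3♯(M) node FOR REAL**
(the EPW record is inapplicable on X3; NO line / R-D / image binder; (M) analogue of cc-typer-2's
`ClassX3Gord.congruentLambdaShift_of_gv_of_torsionIso`, whose R-D binders are here theorems), mod
A40/A41. X3♯(M) stays CONSTRUCTION-SHAPED; nothing booked.
[cite: GreenbergVatsal2000, §2 Prop. (2.8) with Remark (2.9), Cor. (2.3), Prop. (2.4), pp. 26–27 (arXiv:math/9906215)]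
[cite: SilvermanATAEC1994, Ch. V Thm. 5.3, Cor. 5.4] -/
theorem ClassX3M.congruentLambdaShift_of_gv_of_torsionIso
    (hGV : muLambdaAlg_transfer_of_torsionIso_potOrd_of_not_dvd_torsionOrder)
    (hT40 : Silverman1994_thmV53_tateUniformisation.{0})
    (hT41 : Silverman1994_thmV53_corV54_tateUniformisation.{0})
    (hX₁ : ClassX3M W₁ p) (hX₂ : ClassX3M W₂ p)
    (htors₁ : ¬ p ∣ W₁.torsionOrder) (hT : TorsionIso W₁ W₂ p)
    (S₀ : Finset (HeightOneSpectrum (𝓞 ℚ))) (hS₀ : ∀ w ∈ S₀, ((p : ℕ) : 𝓞 ℚ) ∉ w.asIdeal)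
    (hS₁ : ∀ w : HeightOneSpectrum (𝓞 ℚ), w ∉ S₀ → ((p : ℕ) : 𝓞 ℚ) ∉ w.asIdeal →
      W₁.HasGoodReductionAt w)
    (hS₂ : ∀ w : HeightOneSpectrum (𝓞 ℚ), w ∉ S₀ → ((p : ℕ) : 𝓞 ℚ) ∉ w.asIdeal →
      W₂.HasGoodReductionAt w) :
    CongruentLambdaShift W₁ W₂ p (∑ w ∈ S₀, ((delta W₂ p w : ℤ) - (delta W₁ p w : ℤ))) :=
  (ClassX3M.potMult W₁ p hX₁).congruentLambdaShift_of_gv_of_torsionIso hGV hT40 hT41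
    (ClassX3M.p_ne_two W₁ p hX₁) (ClassX3M.potMult W₂ p hX₂) htors₁
    (not_dvd_torsionOrder_of_torsionIso hT htors₁) hT S₀ hS₀ hS₁ hS₂

/-- **X3♯(M)–X3♯(M) congruent pairs (odd `p`): `μ(X(E₁)) = 0 ⟹ μ(X(E₂)) = 0`** from the GV record +
`TorsionIso` + ONE census bit `p ∤ #E₁(ℚ)_tors` + `Σ₀` — NO line / R-D / image binder, mod A40/A41. Nothing booked.
[cite: GreenbergVatsal2000, §2 Prop. (2.8) with Remark (2.9), Cor. (2.3), pp. 26–27 (arXiv:math/9906215)]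
[cite: SilvermanATAEC1994, Ch. V Thm. 5.3, Cor. 5.4] -/
theorem ClassX3M.mu_eq_zero_of_gv_of_torsionIso
    (hGV : muLambdaAlg_transfer_of_torsionIso_potOrd_of_not_dvd_torsionOrder)
    (hT40 : Silverman1994_thmV53_tateUniformisation.{0})
    (hT41 : Silverman1994_thmV53_corV54_tateUniformisation.{0})
    (hX₁ : ClassX3M W₁ p) (hX₂ : ClassX3M W₂ p)
    (htors₁ : ¬ p ∣ W₁.torsionOrder) (hT : TorsionIso W₁ W₂ p)
    (S₀ : Finset (HeightOneSpectrum (𝓞 ℚ))) (hS₀ : ∀ w ∈ S₀, ((p : ℕ) : 𝓞 ℚ) ∉ w.asIdeal)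
    (hS₁ : ∀ w : HeightOneSpectrum (𝓞 ℚ), w ∉ S₀ → ((p : ℕ) : 𝓞 ℚ) ∉ w.asIdeal →
      W₁.HasGoodReductionAt w)
    (hS₂ : ∀ w : HeightOneSpectrum (𝓞 ℚ), w ∉ S₀ → ((p : ℕ) : 𝓞 ℚ) ∉ w.asIdeal →
      W₂.HasGoodReductionAt w)
    {κ : ZpExtension ℚ p} {γ : absoluteGaloisGroup ℚ} (hκ : κ.IsCyclotomic)
    (hγ : κ.IsTopGenerator γ) (hγ' : IsCyclotomicVariable p γ)
    (D₁ : W₁.SelmerDualData κ γ) (D₂ : W₂.SelmerDualData κ γ)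
    [Module.Finite (IwasawaAlgebra p) D₁.X] [Module.Finite (IwasawaAlgebra p) D₂.X]
    (hX₁t : D₁.IsTorsion) (hX₂t : D₂.IsTorsion) (hμ₁ : D₁.mu = 0) : D₂.mu = 0 :=
  (ClassX3M.potMult W₁ p hX₁).mu_eq_zero_of_gv_of_torsionIso hGV hT40 hT41
    (ClassX3M.p_ne_two W₁ p hX₁) (ClassX3M.potMult W₂ p hX₂) htors₁
    (not_dvd_torsionOrder_of_torsionIso hT htors₁) hT S₀ hS₀ hS₁ hS₂ hκ hγ
    hγ' D₁ D₂ hX₁t hX₂t hμ₁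

end GV

end Summit.BirchSwinnertonDyer.Rank1Residual.AdditivePotMult

end
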